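import Mathlib
import HarnessLib
import Literature.NumberTheory.LFunctions.ZetaSubconvexity
import Literature.NumberTheory.LFunctions.HSumStructure
import Literature.NumberTheory.LFunctions.SixthMomentFiveCoordinates

/-!
# The main term of a Huxley–Watt block, five-coordinate form for the arcs `q < R` (PROVED)

Topic `Literature/NumberTheory/LFunctions`. Companion of `HSumStructure.lean` (Bourgain, J. AMS 30
(2017), §4, (3.4); Graham–Kolesnik, LMS LN 126, §7.7). On the arcs `q < R` of the Huxley–Watt
reduction the coefficient `(3/8)κ(qλ)²` of `h^{-1/2}` in
`-κ(h - qλ)^{3/2} = -κh^{3/2} + (3/2)κqλ h^{1/2} - (3/8)κ(qλ)² h^{-1/2} - κρ₂(h)` is `≍ (R/q)²`, too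
large for partial summation; so here only `ρ₂ = ρ - (3/8)τ²h^{-1/2}` (`|ρ₂'| ≤ (9/128)h^{-5/2}`:
`abs_rho2'_le`, `tv_e_rho2_le`) is removed by Abel summation (`weight5_abel_le`,
`norm_sum_weight5_mul_le`), and `h^{-1/2}` becomes the fifth coordinate (`xvec5`, `term_eq5`) of the
five-coordinate `h`-sums `hsum5` of `SixthMomentFiveCoordinates.lean`.

Main result `norm_mainTerm5_le`: under the hypotheses of `HSumStructure.norm_mainTerm_le`,
`‖MT‖ ≤ 2(1 + 5κ H₀^{-3/2})(μqN')^{-1/2}(I⁵₁ + I⁵₋₁)`, `H₀ = μqN'²`,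
`I⁵_ε = ∫₀¹ K_H(θ)‖hsum5From M₀ H (ε e(-θ)) x₅‖dθ` (`thetaIntegral5`), where the `h`-sums are taken over the window
`M₀ < h ≤ H` with any `M₀ + 1 ≤ qλ + 3μqN'²` (`norm_sum_Ioc_nat_le_integral_from`), so that downstream
the fifth box size is `6(M₀+1)^{-1/2}` (`SixthMomentFiveCoordinates.sixthMoment5From_of_corollary3`).

Everything is PROVED; no named fact is introduced.

## References

* J. Bourgain, *Decoupling, exponential sums and the Riemann zeta function*, J. Amer. Math. Soc. 30
  (2017), 205–224 — §4, (3.4). [BourgainJAMS2017]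
* S. W. Graham, G. Kolesnik, *Van der Corput's Method of Exponential Sums*, LMS Lecture Note Series
  126, Cambridge Univ. Press 1991 — §7.7, Lemmas 7.2, 7.3, 7.11, 7.16. [GrahamKolesnik1991]
* M. N. Huxley, N. Watt, *Exponential sums and the Riemann zeta function*, Proc. London Math. Soc.
  (3) 57 (1988), 1–24 — §4. [HuxleyWatt1988]
-/

noncomputable section

open Real Complex Finset Set MeasureTheory
open Literature.Analysis.Fourier (fresnelC norm_fresnelC_le)
open Literature.NumberTheory.EllipticCurves.ModularForms (quadGaussSum)
open Literature.NumberTheory.LFunctions.CubicSum (airyMain stationaryWindow mem_stationaryWindow_iff)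
open Literature.NumberTheory.LFunctions.GaussPhase (gauss_phase_parity)
open Literature.NumberTheory.LFunctions.PartialSums (cutoffKernel norm_sum_Ioc_mul_le_abel
  sum_norm_sub_le_of_deriv norm_sum_Ioc_le_integral_cutoffKernel cutoffKernel_nonneg)

namespace Literature.NumberTheory.LFunctions
namespace HSum

/-! ### The second-order remainder `ρ₂ = ρ - (3/8)τ² h^{-1/2}` -/

/-- `ρ₂_τ(h) = ρ_τ(h) - (3/8)τ²/√h = (h-τ)^{3/2} - h^{3/2} + (3/2)τh^{1/2} - (3/8)τ²h^{-1/2}`. [folklore] -/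
def rho2 (τ h : ℝ) : ℝ := rho τ h - 3 / 8 * τ ^ 2 / Real.sqrt h

/-- `ρ₂'(h) = ρ'(h) + (3/16)τ² h^{-3/2}`. [folklore] -/
def rho2' (τ h : ℝ) : ℝ := rho' τ h + 3 / 16 * τ ^ 2 / (h * Real.sqrt h)

/-- Derivative of `ρ₂`. [folklore] -/
theorem hasDerivAt_rho2 {τ h : ℝ} (hτ : τ < h) (hh : 0 < h) : HasDerivAt (rho2 τ) (rho2' τ h) h := by
  unfold rho2 rho2'
  have h1 := hasDerivAt_rho hτ hh
  have hs : 0 < Real.sqrt h := Real.sqrt_pos.2 hh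
  have h2 : HasDerivAt (fun y => 3 / 8 * τ ^ 2 / Real.sqrt y) (-(3 / 8 * τ ^ 2 * (1 / (2 * Real.sqrt h))) / (Real.sqrt h) ^ 2) h := by
    have := (Real.hasDerivAt_sqrt hh.ne')
    exact (this.inv hs.ne').const_mul (3 / 8 * τ ^ 2) |>.congr_deriv (by field_simp) |> fun h' => by
      simpa [div_eq_mul_inv] using h'
  refine (h1.sub h2).congr_deriv ?_
  rw [Real.sq_sqrt hh.le]
  field_simp
  ring

/-- **`|ρ₂'(h)| ≤ (9/16)|τ|³ h^{-5/2} ≤ (9/128) h^{-5/2}`** for `|τ| ≤ 1/2`, `h ≥ 1`. [folklore] -/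
theorem abs_rho2'_le {τ h : ℝ} (hτ : |τ| ≤ 1 / 2) (hh : 1 ≤ h) :
    |rho2' τ h| ≤ 9 / 128 / (h ^ 2 * Real.sqrt h) := by
  have hτ' := abs_le.1 hτ
  have hh0 : 0 < h := by linarith
  have hτh : τ < h := by linarith
  have hs : 0 < Real.sqrt h := Real.sqrt_pos.2 hh0
  have hs' : 0 < Real.sqrt (h - τ) := Real.sqrt_pos.2 (by linarith)
  have hss : Real.sqrt h * Real.sqrt h = h := Real.mul_self_sqrt hh0.le
  have hss' : Real.sqrt (h - τ) * Real.sqrt (h - τ) = h - τ := Real.mul_self_sqrt (by linarith)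
  set D : ℝ := (Real.sqrt (h - τ) + Real.sqrt h) ^ 2 with hD
  have hDpos : 0 < D := by positivity
  -- `ρ₂' = (3/16) τ² (D - 4h) / (h √h D)`
  have hform : rho2' τ h = 3 / 16 * τ ^ 2 * (D - 4 * h) / (h * Real.sqrt h * D) := by
    rw [rho2', rho'_eq hτh hh0, ← hD]
    field_simp
    ring
  -- `|D - 4h| ≤ 3|τ|` and `D ≥ h`
  have hP : Real.sqrt (h - τ) * Real.sqrt h ≤ h + |τ| := by
    -- `√(h-τ)√h ≤ ((h-τ) + h)/2 = h - τ/2 ≤ h + |τ|`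
    nlinarith [sq_nonneg (Real.sqrt (h - τ) - Real.sqrt h), hss, hss', hτ'.1, hτ'.2, abs_nonneg τ, le_abs_self τ, neg_abs_le τ]
  have hP' : h - |τ| ≤ Real.sqrt (h - τ) * Real.sqrt h := by
    -- `√(h-τ)√h ≥ min(h-τ, h) ≥ h - |τ|`
    have h1 : h - |τ| ≤ h - τ := by linarith [le_abs_self τ]
    have h2 : h - |τ| ≤ h := by linarith [abs_nonneg τ]
    have hpos : 0 ≤ h - |τ| := by linarith
    have e1 : Real.sqrt (h - |τ|) * Real.sqrt (h - |τ|) = h - |τ| := Real.mul_self_sqrt hpos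
    calc h - |τ| = Real.sqrt (h - |τ|) * Real.sqrt (h - |τ|) := e1.symm
      _ ≤ Real.sqrt (h - τ) * Real.sqrt h :=
          mul_le_mul (Real.sqrt_le_sqrt h1) (Real.sqrt_le_sqrt h2) (Real.sqrt_nonneg _) (Real.sqrt_nonneg _)
  have hDexp : D = (h - τ) + 2 * (Real.sqrt (h - τ) * Real.sqrt h) + h := by
    rw [hD]; nlinarith [hss, hss']
  have hD4 : |D - 4 * h| ≤ 3 * |τ| := by
    rw [hDexp, abs_le]
    constructor <;> nlinarith [hP, hP', le_abs_self τ, neg_abs_le τ]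
  have hDh : h ≤ D := by rw [hDexp]; nlinarith [hP', hτ'.1, hτ'.2, abs_le.2 ⟨hτ'.1, hτ'.2⟩]
  rw [hform, abs_div, abs_of_pos (by positivity : 0 < h * Real.sqrt h * D), abs_mul, abs_mul,
    abs_of_pos (by norm_num : (0:ℝ) < 3 / 16), abs_pow, div_le_div_iff₀ (by positivity) (by positivity)]
  -- `3/16 τ² |D-4h| · h²√h ≤ 9/128 · h√h D`
  have hτ2 : |τ| ^ 2 ≤ 1 / 4 := by nlinarith [abs_nonneg τ]
  have hτ3 : |τ| ^ 2 * (3 * |τ|) ≤ 3 / 8 := by nlinarith [abs_nonneg τ]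
  calc 3 / 16 * |τ| ^ 2 * |D - 4 * h| * (h ^ 2 * Real.sqrt h)
      ≤ 3 / 16 * |τ| ^ 2 * (3 * |τ|) * (h ^ 2 * Real.sqrt h) := by gcongr
    _ ≤ 3 / 16 * (3 / 8) * (h ^ 2 * Real.sqrt h) := by
        apply mul_le_mul_of_nonneg_right _ (by positivity)
        nlinarith [hτ3]
    _ = 9 / 128 * (h * Real.sqrt h * h) := by ring
    _ ≤ 9 / 128 * (h * Real.sqrt h * D) := by gcongr


/-! ### Fourier cutoff keeping a lower end `M₀` -/

/-- **Fourier cutoff for `ℕ`-indexed sums with a lower end**: for `M₀ ≤ u ≤ v ≤ H`, `v - u ≤ L`,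
`‖∑_{u<h≤v} c(h)‖ ≤ ∫₀¹ K_L(θ) ‖∑_{M₀<h≤H} c(h) e(-hθ)‖ dθ`. [cite: GrahamKolesnik1991, Lemma 7.3] -/
theorem norm_sum_Ioc_nat_le_integral_from (c : ℕ → ℂ) {M₀ u v H : ℕ} (hMu : M₀ ≤ u) (huv : u ≤ v) (hvH : v ≤ H)
    {L : ℝ} (hL : ((v : ℝ) - u) ≤ L) :
    ‖∑ h ∈ Finset.Ioc u v, c h‖ ≤
      ∫ θ in (0 : ℝ)..1, cutoffKernel L θ *
        ‖∑ h ∈ Finset.Ioc M₀ H, c h * Complex.exp (-(2 * π * I * h * θ))‖ := by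
  set a : ℤ → ℂ := fun n => c n.toNat with ha
  have hmain := norm_sum_Ioc_le_integral_cutoffKernel a (M := (M₀ : ℤ)) (u := (u : ℤ)) (v := (v : ℤ))
    (M₁ := (H : ℤ)) (by exact_mod_cast hMu) (by exact_mod_cast huv) (by exact_mod_cast hvH) (L := L)
    (by push_cast; exact hL)
  have hsum1 : ∑ n ∈ Finset.Ioc (u : ℤ) v, a n = ∑ h ∈ Finset.Ioc u v, c h := by
    refine Finset.sum_nbij' (fun n : ℤ => n.toNat) (fun h : ℕ => (h : ℤ)) ?_ ?_ ?_ ?_ ?_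
    · intro n hn; rw [Finset.mem_Ioc] at hn ⊢; omega
    · intro h hh; rw [Finset.mem_Ioc] at hh ⊢; omega
    · intro n hn; rw [Finset.mem_Ioc] at hn; omega
    · intro h _; simp
    · intro n _; simp [ha]
  have hsum2 : ∀ θ : ℝ, ∑ m ∈ Finset.Ioc (M₀ : ℤ) H, a m * Complex.exp (-(2 * π * I * m * θ)) =
      ∑ h ∈ Finset.Ioc M₀ H, c h * Complex.exp (-(2 * π * I * h * θ)) := by
    intro θ
    refine Finset.sum_nbij' (fun n : ℤ => n.toNat) (fun h : ℕ => (h : ℤ)) ?_ ?_ ?_ ?_ ?_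
    · intro n hn; rw [Finset.mem_Ioc] at hn ⊢; omega
    · intro h hh; rw [Finset.mem_Ioc] at hh ⊢; omega
    · intro n hn; rw [Finset.mem_Ioc] at hn; omega
    · intro h _; simp
    · intro n hn
      rw [Finset.mem_Ioc] at hn
      have hn0 : ((n.toNat : ℕ) : ℤ) = n := Int.toNat_of_nonneg (by omega)
      simp only [ha]
      congr 2
      have : ((n.toNat : ℕ) : ℂ) = (n : ℂ) := by exact_mod_cast hn0
      rw [this]
  rw [hsum1] at hmain
  simp_rw [hsum2] at hmain
  exact hmain

/-! ### Total variation of `e(-κρ₂)` -/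

/-- **Total variation of `e(-κρ₂(h))`:** for `|τ| ≤ 1/2`, `κ ≥ 0`, integers `1 ≤ h₀ ≤ h₁`,
`∑_{h₀<h<h₁} ‖e(-κρ₂(h+1)) - e(-κρ₂(h))‖ ≤ (h₁ - h₀) · 2πκ · (9/128)/(h₀²√h₀)`. [folklore] -/
theorem tv_e_rho2_le {τ κ : ℝ} (hτ : |τ| ≤ 1 / 2) (hκ : 0 ≤ κ) {h₀ h₁ : ℕ} (hh₀ : 1 ≤ h₀) (hh : h₀ ≤ h₁) :
    ∑ h ∈ Finset.Ico (h₀ + 1) h₁,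
      ‖Complex.exp (2 * π * I * (-(κ * rho2 τ (h + 1 : ℕ))) ) - Complex.exp (2 * π * I * (-(κ * rho2 τ h)))‖
      ≤ ((h₁ : ℝ) - h₀) * (2 * π * κ * (9 / 128 / (h₀ ^ 2 * Real.sqrt h₀))) := by
  have hh₀R : (1 : ℝ) ≤ h₀ := by exact_mod_cast hh₀
  set f : ℝ → ℂ := fun y => Complex.exp (2 * π * I * (-(κ * rho2 τ y))) with hf
  set D : ℝ := 2 * π * κ * (9 / 128 / (h₀ ^ 2 * Real.sqrt h₀)) with hD
  have hD0 : 0 ≤ D := by positivity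
  have hτ' := abs_le.1 hτ
  have hderiv : ∀ y ∈ Icc (h₀ : ℝ) h₁, HasDerivWithinAt f (f y * (2 * π * I * (-(κ * rho2' τ y)))) (Icc (h₀ : ℝ) h₁) y := by
    intro y hy
    have hy1 : 1 ≤ y := hh₀R.trans hy.1
    have hρ := hasDerivAt_rho2 (τ := τ) (by linarith) (by linarith)
    have hreal : HasDerivAt (fun y : ℝ => -(κ * rho2 τ y)) (-(κ * rho2' τ y)) y := (hρ.const_mul κ).neg
    have : HasDerivAt (fun y => (2 * π * I * (-(κ * rho2 τ y)) : ℂ)) (2 * π * I * (-(κ * rho2' τ y))) y := by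
      have h1 := (hreal.ofReal_comp).const_mul (2 * π * I)
      simp only [Complex.ofReal_neg, Complex.ofReal_mul] at h1
      exact h1
    exact ((Complex.hasDerivAt_exp _).comp y this).hasDerivWithinAt
  have hbound : ∀ y ∈ Icc (h₀ : ℝ) h₁, ‖f y * (2 * π * I * (-(κ * rho2' τ y)))‖ ≤ D := by
    intro y hy
    have hy1 : 1 ≤ y := hh₀R.trans hy.1
    have hfy : ‖f y‖ = 1 := by
      simp only [hf]
      rw [show (2 * π * I * (-(κ * rho2 τ y)) : ℂ) = ((2 * π * (-(κ * rho2 τ y))) : ℝ) * I by push_cast; ring]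
      exact Complex.norm_exp_ofReal_mul_I _
    rw [norm_mul, hfy, one_mul]
    rw [show (2 * π * I * (-(κ * rho2' τ y)) : ℂ) = ((2 * π * (-(κ * rho2' τ y))) : ℝ) * I by push_cast; ring,
      norm_mul, Complex.norm_I, mul_one, Complex.norm_real, Real.norm_eq_abs, abs_mul,
      abs_of_pos (by positivity : (0:ℝ) < 2 * π), abs_neg, abs_mul, abs_of_nonneg hκ]
    have h1 := abs_rho2'_le hτ hy1
    have h2 : 9 / 128 / (y ^ 2 * Real.sqrt y) ≤ 9 / 128 / (h₀ ^ 2 * Real.sqrt h₀) := by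
      apply div_le_div_of_nonneg_left (by norm_num) (by positivity)
      exact mul_le_mul (pow_le_pow_left₀ (by linarith) hy.1 2) (Real.sqrt_le_sqrt hy.1) (Real.sqrt_nonneg _)
        (by positivity)
    rw [hD]
    calc 2 * π * (κ * |rho2' τ y|) = 2 * π * κ * |rho2' τ y| := by ring
      _ ≤ 2 * π * κ * (9 / 128 / (h₀ ^ 2 * Real.sqrt h₀)) := by gcongr; exact h1.trans h2
  have := sum_norm_sub_le_of_deriv (f := f) hh hD0 hderiv hbound
  simpa [hf] using this

/-! ### The weight with `ρ₂` and its removal by Abel summation -/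

/-- The weight `W₅(h) = w(h - τ) e(-κ ρ₂(h))`. [folklore] -/
def weight5 (μ q τ κ : ℝ) (h : ℕ) : ℂ :=
  (ampl μ q (h - τ) : ℂ) * Complex.exp (2 * π * I * (-(κ * rho2 τ h)))

/-- `|e(-κρ₂(h))| = 1`. [folklore] -/
theorem norm_e_neg_rho2 (κ τ : ℝ) (h : ℕ) : ‖Complex.exp (2 * π * I * (-(κ * rho2 τ h)))‖ = 1 := by
  rw [show (2 * π * I * (-(κ * rho2 τ h)) : ℂ) = ((2 * π * (-(κ * rho2 τ h))) : ℝ) * I by push_cast; ring]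
  exact Complex.norm_exp_ofReal_mul_I _

/-- `‖W₅(h)‖ = w(h - τ)` for `h > τ`. [folklore] -/
theorem norm_weight5 {μ q τ κ : ℝ} (hμ : 0 < μ) (hq : 0 < q) {h : ℕ} (hh : τ < h) :
    ‖weight5 μ q τ κ h‖ = ampl μ q (h - τ) := by
  rw [weight5, norm_mul, norm_e_neg_rho2, mul_one, Complex.norm_real, Real.norm_eq_abs,
    abs_of_pos (ampl_pos hμ hq (by linarith))]

/-- Abel size of the weight `W₅`: `‖W₅(v)‖ + ∑_{n₀<h<v} ‖W₅(h+1) - W₅(h)‖ ≤ w(n₀+1-τ)(1 + V₅)`,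
`V₅ = (v - n₀)·2πκ(9/128)/(n₀²√n₀)`. [folklore] -/
theorem weight5_abel_le {μ q τ κ : ℝ} (hμ : 0 < μ) (hq : 0 < q) (hτ : |τ| ≤ 1 / 2) (hκ : 0 ≤ κ)
    {n₀ v : ℕ} (hn₀ : 1 ≤ n₀) (hv : n₀ + 1 ≤ v) :
    ‖weight5 μ q τ κ v‖ + ∑ h ∈ Finset.Ico (n₀ + 1) v, ‖weight5 μ q τ κ (h + 1) - weight5 μ q τ κ h‖ ≤
      ampl μ q ((n₀ + 1 : ℕ) - τ) * (1 + ((v : ℝ) - n₀) * (2 * π * κ * (9 / 128 / (n₀ ^ 2 * Real.sqrt n₀)))) := by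
  have hτ' := abs_le.1 hτ
  have hn₀R : (1 : ℝ) ≤ n₀ := by exact_mod_cast hn₀
  have hτu : ∀ {h : ℕ}, n₀ + 1 ≤ h → τ < h := fun {h} hh => by
    have : ((n₀ + 1 : ℕ) : ℝ) ≤ h := by exact_mod_cast hh
    push_cast at this; linarith
  have hpos : ∀ {h : ℕ}, n₀ + 1 ≤ h → 0 < (h : ℝ) - τ := fun hh => by linarith [hτu hh]
  set A : ℕ → ℝ := fun h => ampl μ q (h - τ) with hA
  set E : ℕ → ℂ := fun h => Complex.exp (2 * π * I * (-(κ * rho2 τ h))) with hE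
  have hW : ∀ h, weight5 μ q τ κ h = (A h : ℂ) * E h := fun h => rfl
  have hAmono : ∀ {h h' : ℕ}, n₀ + 1 ≤ h → h ≤ h' → A h' ≤ A h := fun {h h'} hh hhh' => by
    simp only [hA]
    exact ampl_antitone hμ hq (hpos hh) (by gcongr)
  have hApos : ∀ {h : ℕ}, n₀ + 1 ≤ h → 0 < A h := fun hh => ampl_pos hμ hq (hpos hh)
  have hstep : ∀ h ∈ Finset.Ico (n₀ + 1) v, ‖weight5 μ q τ κ (h + 1) - weight5 μ q τ κ h‖ ≤
      (A h - A (h + 1)) + A (n₀ + 1) * ‖E (h + 1) - E h‖ := by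
    intro h hh
    rw [Finset.mem_Ico] at hh
    have e : weight5 μ q τ κ (h + 1) - weight5 μ q τ κ h =
        ((A (h + 1) - A h : ℝ) : ℂ) * E (h + 1) + (A h : ℂ) * (E (h + 1) - E h) := by
      rw [hW, hW]; push_cast; ring
    rw [e]
    refine (norm_add_le _ _).trans (add_le_add ?_ ?_)
    · rw [norm_mul, show E (h + 1) = Complex.exp (2 * π * I * (-(κ * rho2 τ (h + 1 : ℕ)))) from rfl,
        norm_e_neg_rho2, mul_one, Complex.norm_real, Real.norm_eq_abs, abs_sub_comm,
        abs_of_nonneg (sub_nonneg.2 (hAmono hh.1 (Nat.le_succ h)))]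
    · rw [norm_mul, Complex.norm_real, Real.norm_eq_abs, abs_of_pos (hApos hh.1)]
      exact mul_le_mul_of_nonneg_right (hAmono le_rfl hh.1) (norm_nonneg _)
  have htel : ∑ h ∈ Finset.Ico (n₀ + 1) v, (A h - A (h + 1)) = A (n₀ + 1) - A v := by
    rw [Finset.sum_Ico_eq_sum_range]
    have := Finset.sum_range_sub' (fun k => A (n₀ + 1 + k)) (v - (n₀ + 1))
    simp only [add_zero] at this
    rw [show n₀ + 1 + (v - (n₀ + 1)) = v by omega] at this
    rw [← this]
    refine Finset.sum_congr rfl fun k _ => ?_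
    rw [show n₀ + 1 + (k + 1) = n₀ + 1 + k + 1 by ring]
  have hvar : ∑ h ∈ Finset.Ico (n₀ + 1) v, ‖E (h + 1) - E h‖ ≤
      ((v : ℝ) - n₀) * (2 * π * κ * (9 / 128 / (n₀ ^ 2 * Real.sqrt n₀))) :=
    tv_e_rho2_le hτ hκ hn₀ (by omega)
  rw [norm_weight5 hμ hq (hτu hv)]
  calc A v + ∑ h ∈ Finset.Ico (n₀ + 1) v, ‖weight5 μ q τ κ (h + 1) - weight5 μ q τ κ h‖
      ≤ A v + ∑ h ∈ Finset.Ico (n₀ + 1) v, ((A h - A (h + 1)) + A (n₀ + 1) * ‖E (h + 1) - E h‖) :=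
        by linarith [Finset.sum_le_sum hstep]
    _ = A v + (A (n₀ + 1) - A v) + A (n₀ + 1) * ∑ h ∈ Finset.Ico (n₀ + 1) v, ‖E (h + 1) - E h‖ := by
        rw [Finset.sum_add_distrib, htel, ← Finset.mul_sum]; ring
    _ ≤ A (n₀ + 1) + A (n₀ + 1) * (((v : ℝ) - n₀) * (2 * π * κ * (9 / 128 / (n₀ ^ 2 * Real.sqrt n₀)))) := by
        have := mul_le_mul_of_nonneg_left hvar (hApos le_rfl).le
        linarith
    _ = A (n₀ + 1) * (1 + ((v : ℝ) - n₀) * (2 * π * κ * (9 / 128 / (n₀ ^ 2 * Real.sqrt n₀)))) := by ring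

/-- Abel summation with the weight `W₅`. [cite: GrahamKolesnik1991, Lemma 7.2] -/
theorem norm_sum_weight5_mul_le {μ q τ κ : ℝ} (hμ : 0 < μ) (hq : 0 < q) (hτ : |τ| ≤ 1 / 2) (hκ : 0 ≤ κ)
    {n₀ v : ℕ} (hn₀ : 1 ≤ n₀) (hv : n₀ + 1 ≤ v) (c : ℕ → ℂ) {B : ℝ}
    (hB : ∀ h'' ∈ Finset.Icc n₀ v, ‖∑ h ∈ Finset.Ioc n₀ h'', c h‖ ≤ B) :
    ‖∑ h ∈ Finset.Ioc n₀ v, weight5 μ q τ κ h * c h‖ ≤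
      ampl μ q ((n₀ + 1 : ℕ) - τ) * (1 + ((v : ℝ) - n₀) * (2 * π * κ * (9 / 128 / (n₀ ^ 2 * Real.sqrt n₀)))) * B := by
  have hB0 : 0 ≤ B := (norm_nonneg _).trans (hB n₀ (Finset.mem_Icc.2 ⟨le_rfl, by omega⟩))
  have h1 := norm_sum_Ioc_mul_le_abel c (weight5 μ q τ κ) (by omega : n₀ ≤ v) hB
  exact h1.trans (mul_le_mul_of_nonneg_right (weight5_abel_le hμ hq hτ hκ hn₀ hv) hB0)

/-! ### The five-coordinate vector and the per-term identity -/

/-- The five-coordinate vector `x₅(I) = ({x₁ + s/q}, {x₂}, -κ, (3/2)κqλ, -(3/8)κ(qλ)²)` of a block: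
coefficients of `(h, h², h^{3/2}, h^{1/2}, h^{-1/2})`. [folklore] -/
def xvec5 (q : ℕ) (abar b : ℤ) (μ s lam : ℝ) : Fin 5 → ℝ :=
  ![fr (-(abar : ℝ) * b / (2 * q) + s / q), fr (-(abar : ℝ) / (4 * q)), -kappa μ q,
    3 / 2 * kappa μ q * (q * lam), -(3 / 8 * kappa μ q * (q * lam) ^ 2)]

/-- The first four coordinates of `x₅` are `xvec`. [folklore] -/
theorem xvec5_castSucc (q : ℕ) (abar b : ℤ) (μ s lam : ℝ) (k : Fin 4) :
    xvec5 q abar b μ s lam (Fin.castSucc k) = xvec q abar b μ s lam k := by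
  fin_cases k <;> rfl

/-- The five-coordinate phase written out (`h ≥ 1`). [folklore] -/
theorem phase5_eq (q : ℕ) (abar b : ℤ) (μ s lam : ℝ) {h : ℕ} (hh : 1 ≤ h) :
    ∑ k, xvec5 q abar b μ s lam k * mono5 h k =
      fr (-(abar : ℝ) * b / (2 * q) + s / q) * h + fr (-(abar : ℝ) / (4 * q)) * (h : ℝ) ^ 2
        + (-kappa μ q) * pow32 h + 3 / 2 * kappa μ q * (q * lam) * Real.sqrt h
        + -(3 / 8 * kappa μ q * (q * lam) ^ 2) * (1 / Real.sqrt h) := by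
  rw [Fin.sum_univ_five]
  simp only [xvec5, mono5, Matrix.cons_val_zero, Matrix.cons_val_one, Matrix.head_cons,
    Matrix.cons_val_two, Matrix.tail_cons, Matrix.cons_val_three, Matrix.cons_val_four]
  have h0 : (0 : ℝ) < h := by exact_mod_cast hh
  have h32 : (h : ℝ) ^ (3 / 2 : ℝ) = pow32 h := by
    rw [pow32, show (3 / 2 : ℝ) = 1 + 1 / 2 by norm_num, Real.rpow_add' h0.le (by norm_num), Real.rpow_one,
      Real.sqrt_eq_rpow]
  have h12 : (h : ℝ) ^ (1 / 2 : ℝ) = Real.sqrt h := (Real.sqrt_eq_rpow _).symm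
  have hm12 : (h : ℝ) ^ (-(1 / 2) : ℝ) = 1 / Real.sqrt h := by
    rw [Real.rpow_neg h0.le, ← Real.sqrt_eq_rpow, one_div]
  rw [h32, h12, hm12]

/-- **One term of the main sum, five-coordinate form**: as `term_eq`, but the remainder kept in the
weight is `ρ₂ = ρ - (3/8)τ²h^{-1/2}` and the term `-(3/8)κτ² h^{-1/2}` joins the phase. [folklore] -/
theorem term_eq5 {q : ℕ} (hq : 0 < q) {abar b : ℤ} {γ : ℂ} {μ s lam : ℝ} (hμ : 0 < μ)
    (hlam : |q * lam| ≤ 1 / 2) {h : ℕ} (hh : 1 ≤ h) (G : ℂ)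
    (hGeq : G = γ * Complex.exp (2 * π * I * ((-(abar : ℝ) / (4 * q)) * (h : ℤ) ^ 2
      + (-(abar : ℝ) * b / (2 * q)) * (h : ℤ) : ℝ))) :
    G * (Complex.exp (2 * π * I * (((h : ℤ) - q * lam) / q * s : ℝ)) * airyMain μ q ((h : ℤ) - q * lam)) =
      (γ * fresnelC * Complex.exp (2 * π * I * (-(lam * s) : ℝ))) *
        (weight5 μ q (q * lam) (kappa μ q) h * VdC.e (∑ k, xvec5 q abar b μ s lam k * mono5 h k)) := by
  have hqR : (0 : ℝ) < q := by exact_mod_cast hq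
  have hτ' := abs_le.1 hlam
  have hhR : (1 : ℝ) ≤ h := by exact_mod_cast hh
  have hhtau : 0 ≤ (h : ℝ) - q * lam := by linarith
  have hs0 : Real.sqrt h ≠ 0 := (Real.sqrt_pos.2 (by linarith : (0:ℝ) < h)).ne'
  rw [hGeq, show (((h : ℤ) : ℝ) - q * lam) = (h : ℝ) - q * lam by push_cast; ring,
    airyMain_eq hμ hqR hhtau, weight5, phase5_eq q abar b μ s lam hh, e_eq_exp]
  set x₂ : ℝ := -(abar : ℝ) / (4 * q) with hx₂
  set x₁ : ℝ := -(abar : ℝ) * b / (2 * q) with hx₁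
  set κ : ℝ := kappa μ q with hκ
  set τ : ℝ := q * lam with hτ
  set A : ℝ := x₂ * (h : ℝ) ^ 2 + x₁ * h + ((h : ℝ) - τ) / q * s + -(κ * pow32 ((h : ℝ) - τ)) with hA
  set B : ℝ := -(lam * s) + -(κ * rho2 τ h) + (fr (x₁ + s / q) * h + fr x₂ * (h : ℝ) ^ 2
    + -κ * pow32 h + 3 / 2 * κ * τ * Real.sqrt h + -(3 / 8 * κ * τ ^ 2) * (1 / Real.sqrt h)) with hB
  set n : ℤ := round x₂ * (h : ℤ) ^ 2 + round (x₁ + s / q) * h with hn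
  have hAB : A = B + n := by
    simp only [hA, hB, hn, fr, rho2, rho, hτ]
    push_cast
    field_simp
    ring
  have hL : γ * Complex.exp (2 * π * I * ((x₂ * ((h : ℤ) : ℝ) ^ 2 + x₁ * ((h : ℤ) : ℝ)) : ℝ)) *
      (Complex.exp (2 * π * I * (((h : ℝ) - q * lam) / q * s : ℝ)) *
        (fresnelC * (ampl μ q ((h : ℝ) - q * lam) : ℂ) * Complex.exp (2 * π * I * (-(kappa μ q * pow32 ((h : ℝ) - q * lam)) : ℝ))))
      = γ * fresnelC * (ampl μ q ((h : ℝ) - τ) : ℂ) * Complex.exp (2 * π * I * A) := by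
    have : Complex.exp (2 * π * I * A) = Complex.exp (2 * π * I * ((x₂ * ((h : ℤ) : ℝ) ^ 2 + x₁ * ((h : ℤ) : ℝ)) : ℝ))
        * Complex.exp (2 * π * I * (((h : ℝ) - q * lam) / q * s : ℝ))
        * Complex.exp (2 * π * I * (-(kappa μ q * pow32 ((h : ℝ) - q * lam)) : ℝ)) := by
      rw [← Complex.exp_add, ← Complex.exp_add]
      congr 1
      simp only [hA, hκ, hτ]
      push_cast
      ring
    rw [this]
    ring
  have hR : (γ * fresnelC * Complex.exp (2 * π * I * (-(lam * s) : ℝ))) *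
      (((ampl μ q ((h : ℝ) - τ) : ℂ) * Complex.exp (2 * π * I * (-(κ * rho2 τ h)))) *
        Complex.exp (2 * π * I * ((fr (x₁ + s / q) * h + fr x₂ * (h : ℝ) ^ 2 + -κ * pow32 h
          + 3 / 2 * κ * τ * Real.sqrt h + -(3 / 8 * κ * τ ^ 2) * (1 / Real.sqrt h) : ℝ))))
      = γ * fresnelC * (ampl μ q ((h : ℝ) - τ) : ℂ) * Complex.exp (2 * π * I * B) := by
    have : Complex.exp (2 * π * I * B) = Complex.exp (2 * π * I * (-(lam * s) : ℝ))
        * Complex.exp (2 * π * I * (-(κ * rho2 τ h)))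
        * Complex.exp (2 * π * I * ((fr (x₁ + s / q) * h + fr x₂ * (h : ℝ) ^ 2 + -κ * pow32 h
          + 3 / 2 * κ * τ * Real.sqrt h + -(3 / 8 * κ * τ ^ 2) * (1 / Real.sqrt h) : ℝ))) := by
      rw [← Complex.exp_add, ← Complex.exp_add]
      congr 1
      simp only [hB]
      push_cast
      ring
    rw [this]
    ring
  rw [hL, hR, hAB]
  congr 1
  push_cast
  rw [show (2 * π * I * ((B : ℂ) + (n : ℂ)) : ℂ) = 2 * π * I * B + n * (2 * π * I) by ring, Complex.exp_add,
    Complex.exp_int_mul_two_pi_mul_I, mul_one]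

/-- The twisted window sum is `hsum5From M₀ H (ε e(-θ)) x`. [folklore] -/
theorem sum_twist_eq_hsum5From (M₀ H : ℕ) (ε : ℂ) (x : Fin 5 → ℝ) (θ : ℝ) :
    ∑ h ∈ Finset.Ioc M₀ H, (ε ^ h * VdC.e (∑ k, x k * mono5 h k)) * Complex.exp (-(2 * π * I * h * θ))
      = hsum5From M₀ H (ε * Complex.exp (-(2 * π * I * θ))) x := by
  rw [hsum5From, ← Finset.Icc_add_one_left_eq_Ioc]
  refine Finset.sum_congr rfl fun h _ => ?_
  rw [mul_pow, ← Complex.exp_nat_mul, show ((h : ℂ) * -(2 * π * I * θ)) = -(2 * π * I * h * θ) by ring]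
  ring

/-- `I⁵_ε = ∫₀¹ K_H(θ) ‖hsum5From M₀ H (ε e(-θ)) x‖ dθ`. [folklore] -/
def thetaIntegral5 (M₀ H : ℕ) (ε : ℂ) (x : Fin 5 → ℝ) : ℝ :=
  ∫ θ in (0 : ℝ)..1, cutoffKernel H θ * ‖hsum5From M₀ H (ε * Complex.exp (-(2 * π * I * θ))) x‖

/-- `I⁵_ε ≥ 0`. [folklore] -/
theorem thetaIntegral5_nonneg (M₀ H : ℕ) (ε : ℂ) (x : Fin 5 → ℝ) : 0 ≤ thetaIntegral5 M₀ H ε x := by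
  unfold thetaIntegral5
  refine intervalIntegral.integral_nonneg zero_le_one fun θ hθ => ?_
  exact mul_nonneg (PartialSums.cutoffKernel_nonneg (Nat.cast_nonneg _) hθ.1 hθ.2) (norm_nonneg _)

set_option maxHeartbeats 1000000 in
/-- **Five-coordinate form of the main term of a minor Huxley–Watt block** (for the arcs `q < R`):
as `norm_mainTerm_le`, but only `ρ₂ = ρ - (3/8)τ²h^{-1/2}` is removed by partial summation (its
variation costs `1 + 5κ/H₀^{3/2}`, `H₀ = μqN'²`, instead of `1 + 6/(μq²N')`), and the term
`-(3/8)κτ²h^{-1/2}` is the fifth coordinate of `x₅ = xvec5 q ā b μ s λ`: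
`‖MT‖ ≤ 2(1 + 5κ H₀^{-3/2})(μqN')^{-1/2}(I⁵₁ + I⁵₋₁)`, `I⁵_ε = ∫₀¹ K_H(θ)‖hsum5From M₀ H (ε e(-θ)) x₅‖dθ`.
[cite: BourgainJAMS2017, §4 eq. (3.4)] [cite: GrahamKolesnik1991, §7.7] -/
theorem norm_mainTerm5_le {q : ℕ} [NeZero q] {a b abar : ℤ} (hab : (a : ZMod q) * (abar : ZMod q) = 1)
    {μ s lam : ℝ} {L n₁ H M₀ : ℕ} (hμ : 0 < μ) (hlam : |q * lam| ≤ 1 / 2) (hN' : 1 ≤ (L : ℝ) + s)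
    (hn₁ : L ≤ n₁) (hN₁' : (n₁ : ℝ) + s ≤ 2 * (L + s)) (hH₀ : 1 ≤ μ * q * (L + s) ^ 2)
    (hHcap : q * lam + 3 * μ * q * (n₁ + s) ^ 2 ≤ H) (hM₀ : (M₀ : ℝ) + 1 ≤ q * lam + 3 * μ * q * (L + s) ^ 2) :
    ‖(1 / (q : ℂ)) * ∑ h ∈ stationaryWindow q μ s lam L n₁,
        quadGaussSum q a ((b : ZMod q) + (h : ZMod q)) *
          (Complex.exp (2 * π * I * ((h - q * lam) / q * s : ℝ)) * airyMain μ q (h - q * lam))‖ ≤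
      2 * (1 + 5 * kappa μ q / (μ * q * (L + s) ^ 2 * Real.sqrt (μ * q * (L + s) ^ 2))) / Real.sqrt (μ * q * (L + s)) *
        (thetaIntegral5 M₀ H 1 (xvec5 q abar b μ s lam) + thetaIntegral5 M₀ H (-1) (xvec5 q abar b μ s lam)) := by
  classical
  have hq : 0 < q := Nat.pos_of_ne_zero (NeZero.ne q)
  have hqR : (0 : ℝ) < q := by exact_mod_cast hq
  have hτ' := abs_le.1 hlam
  set x := xvec5 q abar b μ s lam with hx
  set τ : ℝ := q * lam with hτdef
  set κ : ℝ := kappa μ q with hκdef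
  have hκ0 : 0 ≤ κ := (kappa_pos hμ hqR).le
  set N' : ℝ := (L : ℝ) + s with hN'def
  have hN'0 : 0 < N' := by linarith
  set H₀ : ℝ := μ * q * N' ^ 2 with hH₀def
  -- the window as an integer interval
  set uZ : ℤ := ⌈q * lam + 3 * μ * q * ((L : ℝ) + s) ^ 2⌉ with huZ
  set vZ : ℤ := ⌊q * lam + 3 * μ * q * ((n₁ : ℝ) + s) ^ 2⌋ with hvZ
  have hW : stationaryWindow q μ s lam L n₁ = Finset.Icc uZ vZ := rfl
  have huZ_ge : τ + 3 * H₀ ≤ uZ := by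
    rw [huZ]
    refine le_trans (le_of_eq ?_) (Int.le_ceil _)
    simp only [hτdef, hH₀def, hN'def]; ring
  have huZ2 : (2 : ℤ) ≤ uZ := by
    have : (2 : ℝ) < uZ := by
      have h3 : 3 ≤ 3 * H₀ := by rw [hH₀def]; nlinarith
      linarith
    exact_mod_cast this.le
  have hvZ_le : (vZ : ℝ) ≤ τ + 3 * μ * q * ((n₁ : ℝ) + s) ^ 2 := Int.floor_le _
  have hvZH : vZ ≤ (H : ℤ) := by
    have : (vZ : ℝ) ≤ H := hvZ_le.trans hHcap
    exact_mod_cast this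
  have hpref0 : 0 ≤ 2 * (1 + 5 * kappa μ q / (μ * q * (L + s) ^ 2 * Real.sqrt (μ * q * (L + s) ^ 2))) /
      Real.sqrt (μ * q * (L + s)) := by
    have : 0 < μ * q * (L + s) ^ 2 := by rw [← hN'def]; positivity
    have : 0 < μ * q * (L + s) := by rw [← hN'def]; positivity
    have := hκ0
    positivity
  -- empty window: nothing to prove (the right-hand side is `≥ 0` once `H ≥ 1`; if `H = 0` it is `0`)
  rcases lt_or_ge vZ uZ with hempty | huv
  · rw [hW, Finset.Icc_eq_empty (not_le.2 hempty), Finset.sum_empty, mul_zero, norm_zero]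
    refine mul_nonneg hpref0 (add_nonneg ?_ ?_) <;>
    · exact thetaIntegral5_nonneg M₀ H _ x
  -- nonempty window: `2 ≤ uZ ≤ vZ ≤ H`
  have hH1 : 1 ≤ H := by
    have : (2 : ℤ) ≤ H := huZ2.trans (huv.trans hvZH)
    omega
  have hI0 : ∀ ε : ℂ, 0 ≤ thetaIntegral5 M₀ H ε x := fun ε => thetaIntegral5_nonneg M₀ H ε x
  -- pass to natural numbers
  set u : ℕ := uZ.toNat with hudef
  set v : ℕ := vZ.toNat with hvdef
  have huz : (u : ℤ) = uZ := Int.toNat_of_nonneg (by omega)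
  have hvz : (v : ℤ) = vZ := Int.toNat_of_nonneg (by omega)
  have hu2 : 2 ≤ u := by omega
  have huv' : u ≤ v := by omega
  have hvH : v ≤ H := by omega
  have huR : (u : ℝ) = uZ := by exact_mod_cast huz
  have hvR : (v : ℝ) = vZ := by exact_mod_cast hvz
  have hM₀u : M₀ ≤ u - 1 := by
    have h1 : (M₀ : ℝ) + 1 ≤ uZ := by
      refine hM₀.trans ?_
      have : τ + 3 * H₀ = q * lam + 3 * μ * q * ((L : ℝ) + s) ^ 2 := by
        simp only [hτdef, hH₀def, hN'def]; ring
      linarith [huZ_ge]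
    have h2 : (M₀ : ℤ) + 1 ≤ uZ := by exact_mod_cast h1
    omega
  -- the summand as a function of `h : ℕ`
  set F : ℕ → ℂ := fun h => quadGaussSum q a ((b : ZMod q) + ((h : ℤ) : ZMod q)) *
    (Complex.exp (2 * π * I * ((((h : ℤ) : ℝ) - q * lam) / q * s : ℝ)) * airyMain μ q (((h : ℤ) : ℝ) - q * lam))
    with hFdef
  have hsumN : ∑ h ∈ stationaryWindow q μ s lam L n₁,
      quadGaussSum q a ((b : ZMod q) + (h : ZMod q)) *
        (Complex.exp (2 * π * I * ((h - q * lam) / q * s : ℝ)) * airyMain μ q (h - q * lam))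
      = ∑ h ∈ Finset.Icc u v, F h := by
    rw [hW]
    refine Finset.sum_nbij' (fun n : ℤ => n.toNat) (fun h : ℕ => (h : ℤ)) ?_ ?_ ?_ ?_ ?_
    · intro n hn; rw [Finset.mem_Icc] at hn ⊢
      exact ⟨by rw [hudef]; exact Int.toNat_le_toNat hn.1, by rw [hvdef]; exact Int.toNat_le_toNat hn.2⟩
    · intro h hh; rw [Finset.mem_Icc] at hh ⊢
      exact ⟨by rw [← huz]; exact_mod_cast hh.1, by rw [← hvz]; exact_mod_cast hh.2⟩
    · intro n hn; rw [Finset.mem_Icc] at hn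
      exact Int.toNat_of_nonneg (by omega)
    · intro h _; simp
    · intro n hn
      rw [Finset.mem_Icc] at hn
      have hn0 : ((n.toNat : ℕ) : ℤ) = n := Int.toNat_of_nonneg (by omega)
      simp only [hFdef, hn0]
  rw [hsumN]
  -- the phase function and the two parity pieces
  set Φ : ℕ → ℂ := fun h => VdC.e (∑ k, x k * mono5 h k) with hΦdef
  set W : ℕ → ℂ := fun h => weight5 μ q τ κ h with hWdef
  have hsplit : ∑ h ∈ Finset.Icc u v, F h =
      ∑ h ∈ (Finset.Icc u v).filter (fun h => h % 2 = 0 % 2), F h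
        + ∑ h ∈ (Finset.Icc u v).filter (fun h => h % 2 = 1 % 2), F h := by
    rw [← Finset.sum_filter_add_sum_filter_not (Finset.Icc u v) (fun h => h % 2 = 0 % 2)]
    congr 1
    exact Finset.sum_congr (Finset.filter_congr fun h _ => by omega) fun _ _ => rfl
  -- each parity piece: `C_r * ∑_{Ioc (u-1) v} W(h) c_r(h)`
  have hpiece : ∀ r : ℕ, ∃ C : ℂ, ‖C‖ ≤ Real.sqrt (2 * q) * 6 ∧
      ∑ h ∈ (Finset.Icc u v).filter (fun h => h % 2 = r % 2), F h =
        C * ∑ h ∈ Finset.Ioc (u - 1) v, W h * (if h % 2 = r % 2 then Φ h else 0) := by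
    intro r
    obtain ⟨γ, hγ, hG⟩ := gauss_phase_parity (c := q) hab b (r : ℤ)
    refine ⟨γ * fresnelC * Complex.exp (2 * π * I * (-(lam * s) : ℝ)), ?_, ?_⟩
    · rw [norm_mul, norm_mul, show (2 * π * I * (-(lam * s) : ℝ) : ℂ) = ((2 * π * (-(lam * s))) : ℝ) * I by push_cast; ring,
        Complex.norm_exp_ofReal_mul_I, mul_one]
      exact mul_le_mul hγ norm_fresnelC_le (norm_nonneg _) (Real.sqrt_nonneg _)
    · have hIcc : Finset.Icc u v = Finset.Ioc (u - 1) v := by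
        ext h; simp only [Finset.mem_Icc, Finset.mem_Ioc]; omega
      rw [hIcc, Finset.mul_sum, Finset.sum_filter]
      refine Finset.sum_congr rfl fun h hh => ?_
      rw [Finset.mem_Ioc] at hh
      by_cases hp : h % 2 = r % 2
      · rw [if_pos hp, if_pos hp]
        have hcast : ((h : ℤ) % 2) = ((r : ℤ) % 2) := by exact_mod_cast hp
        have hGh := hG (h : ℤ) hcast
        have := term_eq5 (abar := abar) (b := b) (γ := γ) (s := s) hq hμ hlam (by omega : 1 ≤ h)
          (quadGaussSum q a ((b : ZMod q) + ((h : ℤ) : ZMod q))) hGh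
        simp only [hFdef]
        rw [this]
      · rw [if_neg hp, if_neg hp]; simp
  -- the common bound for the partial sums of `c_r`
  have hB : ∀ r : ℕ, ∀ h'' ∈ Finset.Icc (u - 1) v,
      ‖∑ h ∈ Finset.Ioc (u - 1) h'', (if h % 2 = r % 2 then Φ h else 0)‖ ≤
        (1 / 2) * (thetaIntegral5 M₀ H 1 x + thetaIntegral5 M₀ H (-1) x) := by
    intro r h'' hh''
    rw [Finset.mem_Icc] at hh''
    rw [← Finset.sum_filter]
    refine (norm_sum_filter_parity_le Φ _ r).trans ?_
    gcongr
    · -- `ε = 1`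
      have h1 := norm_sum_Ioc_nat_le_integral_from Φ (M₀ := M₀) (u := u - 1) (v := h'') (H := H) hM₀u hh''.1
        (by omega) (L := H)
        (by have : (h'' : ℝ) ≤ H := by exact_mod_cast (show h'' ≤ H by omega)
            linarith [(Nat.cast_nonneg (u - 1) : (0:ℝ) ≤ ((u - 1 : ℕ) : ℝ))])
      refine h1.trans (le_of_eq ?_)
      unfold thetaIntegral5
      refine intervalIntegral.integral_congr fun θ _ => ?_
      congr 2
      rw [← sum_twist_eq_hsum5From M₀ H 1 x θ]
      refine Finset.sum_congr rfl fun h _ => ?_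
      simp [hΦdef]
    · -- `ε = -1`
      have h1 := norm_sum_Ioc_nat_le_integral_from (fun h => (-1 : ℂ) ^ h * Φ h) (M₀ := M₀) (u := u - 1) (v := h'')
        (H := H) hM₀u hh''.1 (by omega) (L := H)
        (by have : (h'' : ℝ) ≤ H := by exact_mod_cast (show h'' ≤ H by omega)
            linarith [(Nat.cast_nonneg (u - 1) : (0:ℝ) ≤ ((u - 1 : ℕ) : ℝ))])
      refine h1.trans (le_of_eq ?_)
      unfold thetaIntegral5
      refine intervalIntegral.integral_congr fun θ _ => ?_
      congr 2
      rw [← sum_twist_eq_hsum5From M₀ H (-1) x θ]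
  -- Abel per parity piece
  have hu1 : 1 ≤ u - 1 := by omega
  have huu : u - 1 + 1 = u := by omega
  have hamp : ampl μ q ((u - 1 + 1 : ℕ) - τ) ≤ 1 / Real.sqrt (12 * π * μ * N') := by
    rw [huu]
    refine ampl_le hμ hqR hN'0 ?_
    have e : (3 * μ * q * N' ^ 2 : ℝ) = 3 * H₀ := by rw [hH₀def]; ring
    rw [e]
    linarith [huZ_ge, huR]
  set V : ℝ := ((v : ℝ) - (u - 1 : ℕ)) * (2 * π * κ * (9 / 128 / (((u - 1 : ℕ) : ℝ) ^ 2 * Real.sqrt (u - 1 : ℕ)))) with hVdef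
  have hV : V ≤ 5 * κ / (H₀ * Real.sqrt H₀) := by
    have hu1R : ((u - 1 : ℕ) : ℝ) = u - 1 := by
      rw [Nat.cast_sub (by omega)]; simp
    have hH₀1 : 1 ≤ H₀ := by rw [hH₀def]; exact hH₀
    have hcount : (v : ℝ) - (u - 1 : ℕ) ≤ 11 * H₀ := by
      rw [hu1R, hvR]
      have hmono : 3 * μ * q * ((n₁ : ℝ) + s) ^ 2 ≤ 12 * H₀ := by
        rw [hH₀def]
        have : ((n₁ : ℝ) + s) ^ 2 ≤ 4 * N' ^ 2 := by
          have hlow : -(2 * N') ≤ (n₁ : ℝ) + s := by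
            have : (L : ℝ) ≤ n₁ := by exact_mod_cast hn₁
            rw [hN'def]; linarith
          nlinarith [hN₁', hlow]
        have hμq : 0 ≤ μ * q := by positivity
        nlinarith [mul_le_mul_of_nonneg_left this hμq]
      have h1 : (uZ : ℝ) ≥ τ + 3 * H₀ := huZ_ge
      linarith [hvZ_le]
    have hden : H₀ ≤ ((u - 1 : ℕ) : ℝ) := by
      rw [hu1R, huR]; linarith [huZ_ge, hτ'.1]
    have h2u : (2 : ℝ) ≤ u := by exact_mod_cast hu2
    have hu1pos : 0 < ((u - 1 : ℕ) : ℝ) := by rw [hu1R]; linarith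
    have hH₀pos : 0 < H₀ := by positivity
    have hfrac : 9 / 128 / (((u - 1 : ℕ) : ℝ) ^ 2 * Real.sqrt (u - 1 : ℕ)) ≤ 9 / 128 / (H₀ ^ 2 * Real.sqrt H₀) := by
      apply div_le_div_of_nonneg_left (by norm_num) (by positivity)
      exact mul_le_mul (pow_le_pow_left₀ hH₀pos.le hden 2) (Real.sqrt_le_sqrt hden) (Real.sqrt_nonneg _)
        (by positivity)
    have huvR : (u : ℝ) ≤ v := by exact_mod_cast huv'
    have hc0 : 0 ≤ (v : ℝ) - (u - 1 : ℕ) := by rw [hu1R]; linarith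
    have hVle : V ≤ 11 * H₀ * (2 * π * κ * (9 / 128 / (H₀ ^ 2 * Real.sqrt H₀))) := by
      rw [hVdef]
      exact mul_le_mul hcount (mul_le_mul_of_nonneg_left hfrac (by positivity)) (by positivity) (by positivity)
    have hid : 11 * H₀ * (2 * π * κ * (9 / 128 / (H₀ ^ 2 * Real.sqrt H₀))) = (99 * π / 64) * (κ / (H₀ * Real.sqrt H₀)) := by
      field_simp
      ring
    have hpi : 99 * π / 64 ≤ 5 := by have := Real.pi_lt_d2; linarith
    have hκH0 : 0 ≤ κ / (H₀ * Real.sqrt H₀) := by positivity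
    calc V ≤ (99 * π / 64) * (κ / (H₀ * Real.sqrt H₀)) := hVle.trans (le_of_eq hid)
      _ ≤ 5 * (κ / (H₀ * Real.sqrt H₀)) := by gcongr
      _ = 5 * κ / (H₀ * Real.sqrt H₀) := by ring
  -- bound each piece
  have hV0 : 0 ≤ V := by
    rw [hVdef]
    have hu1R : ((u - 1 : ℕ) : ℝ) = u - 1 := by rw [Nat.cast_sub (by omega)]; simp
    have huvR : (u : ℝ) ≤ v := by exact_mod_cast huv'
    have hc0 : 0 ≤ (v : ℝ) - (u - 1 : ℕ) := by rw [hu1R]; linarith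
    positivity
  have hpieceBound : ∀ r : ℕ, ‖∑ h ∈ (Finset.Icc u v).filter (fun h => h % 2 = r % 2), F h‖ ≤
      (Real.sqrt (2 * q) * 6) * ((1 / Real.sqrt (12 * π * μ * N')) * (1 + V) *
        ((1 / 2) * (thetaIntegral5 M₀ H 1 x + thetaIntegral5 M₀ H (-1) x))) := by
    intro r
    obtain ⟨C, hC, hCeq⟩ := hpiece r
    rw [hCeq, norm_mul]
    have hAbel := norm_sum_weight5_mul_le (μ := μ) (q := (q : ℝ)) (τ := τ) (κ := κ) hμ hqR (by rw [hτdef]; exact hlam) hκ0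
      hu1 (by omega : u - 1 + 1 ≤ v) (fun h => if h % 2 = r % 2 then Φ h else 0) (hB r)
    refine mul_le_mul hC (hAbel.trans ?_) (norm_nonneg _) (by positivity)
    have hBB : 0 ≤ (1 / 2) * (thetaIntegral5 M₀ H 1 x + thetaIntegral5 M₀ H (-1) x) := by
      have := hI0 1; have := hI0 (-1); positivity
    exact mul_le_mul_of_nonneg_right (mul_le_mul_of_nonneg_right hamp (by linarith)) hBB
  -- combine the two parity pieces
  set P : ℝ := (Real.sqrt (2 * q) * 6) * ((1 / Real.sqrt (12 * π * μ * N')) * (1 + V) *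
    ((1 / 2) * (thetaIntegral5 M₀ H 1 x + thetaIntegral5 M₀ H (-1) x))) with hPdef
  have htot : ‖∑ h ∈ Finset.Icc u v, F h‖ ≤ 2 * P := by
    rw [hsplit]
    refine (norm_add_le _ _).trans ?_
    have h0 := hpieceBound 0
    have h1 := hpieceBound 1
    linarith
  rw [norm_mul, norm_div, norm_one, Complex.norm_natCast]
  -- the numerical prefactor
  set Isum : ℝ := thetaIntegral5 M₀ H 1 x + thetaIntegral5 M₀ H (-1) x with hIsum
  have hIsum0 : 0 ≤ Isum := add_nonneg (hI0 1) (hI0 (-1))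
  have hsqμN : 0 < Real.sqrt (μ * N') := Real.sqrt_pos.2 (by positivity)
  have hsqq : 0 < Real.sqrt q := Real.sqrt_pos.2 hqR
  have e1 : Real.sqrt (2 * q) = Real.sqrt 2 * Real.sqrt q := Real.sqrt_mul (by norm_num) _
  have e2 : Real.sqrt (12 * π * μ * N') = Real.sqrt (12 * π) * Real.sqrt (μ * N') := by
    rw [show 12 * π * μ * N' = (12 * π) * (μ * N') by ring, Real.sqrt_mul (by positivity)]
  have e3 : Real.sqrt (μ * q * N') = Real.sqrt q * Real.sqrt (μ * N') := by
    rw [show μ * q * N' = q * (μ * N') by ring, Real.sqrt_mul hqR.le]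
  have hnum : 6 * Real.sqrt 2 ≤ 2 * Real.sqrt (12 * π) := by
    have hs2 : Real.sqrt 2 ≤ 3 / 2 := by rw [Real.sqrt_le_left (by norm_num)]; norm_num
    have hs12 : 6 ≤ Real.sqrt (12 * π) := by
      rw [Real.le_sqrt (by norm_num) (by positivity)]; nlinarith [Real.pi_gt_three]
    linarith
  have hqq : Real.sqrt q * Real.sqrt q = q := Real.mul_self_sqrt hqR.le
  calc 1 / (q : ℝ) * ‖∑ h ∈ Finset.Icc u v, F h‖ ≤ 1 / (q : ℝ) * (2 * P) := by gcongr
    _ = (6 * Real.sqrt (2 * q) / ((q : ℝ) * Real.sqrt (12 * π * μ * N'))) * (1 + V) * Isum := by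
        rw [hPdef]; ring
    _ ≤ (2 / Real.sqrt (μ * q * N')) * (1 + 5 * κ / (H₀ * Real.sqrt H₀)) * Isum := by
        have hV' : 1 + V ≤ 1 + 5 * κ / (H₀ * Real.sqrt H₀) := by linarith
        have hfac : 6 * Real.sqrt (2 * q) / ((q : ℝ) * Real.sqrt (12 * π * μ * N')) ≤ 2 / Real.sqrt (μ * q * N') := by
          rw [e1, e2, e3, div_le_div_iff₀ (by positivity) (by positivity)]
          -- `6 √2 √q (√q √(μN')) ≤ 2 (q √(12π) √(μN'))`
          have : 6 * (Real.sqrt 2 * Real.sqrt q) * (Real.sqrt q * Real.sqrt (μ * N'))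
              = (6 * Real.sqrt 2) * (q * Real.sqrt (μ * N')) := by
            calc 6 * (Real.sqrt 2 * Real.sqrt q) * (Real.sqrt q * Real.sqrt (μ * N'))
                = 6 * Real.sqrt 2 * (Real.sqrt q * Real.sqrt q) * Real.sqrt (μ * N') := by ring
              _ = (6 * Real.sqrt 2) * (q * Real.sqrt (μ * N')) := by rw [hqq]; ring
          rw [this, show 2 * ((q : ℝ) * (Real.sqrt (12 * π) * Real.sqrt (μ * N'))) =
            (2 * Real.sqrt (12 * π)) * (q * Real.sqrt (μ * N')) by ring]
          exact mul_le_mul_of_nonneg_right hnum (by positivity)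
        have hfac0 : 0 ≤ 6 * Real.sqrt (2 * q) / ((q : ℝ) * Real.sqrt (12 * π * μ * N')) := by positivity
        have h1V : 0 ≤ 1 + V := by linarith
        apply mul_le_mul_of_nonneg_right _ hIsum0
        exact mul_le_mul hfac hV' h1V (by positivity)
    _ = 2 * (1 + 5 * kappa μ q / (μ * q * (L + s) ^ 2 * Real.sqrt (μ * q * (L + s) ^ 2))) /
          Real.sqrt (μ * q * (L + s)) * Isum := by rw [hκdef, hH₀def, hN'def]; ring

end HSum
end Literature.NumberTheory.LFunctions
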